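import Summits.QuantumFields.YangMills.Theorems.UnitScaleTiltProp7SectET3BgClass
import Literature.MathematicalPhysics.QuantumFieldTheory.Balaban1983to89.B9Thm312WholeFromThm310L2
import Literature.MathematicalPhysics.QuantumFieldTheory.Balaban1983to89.B9RWSumsDefinitePinsPairM
import Literature.MathematicalPhysics.QuantumFieldTheory.Balaban1983to89.B9Thm312WholeStepFrom3131
import Literature.MathematicalPhysics.QuantumFieldTheory.Balaban1983to89.B9RWSums347DefiniteFaces
import HarnessLib

/-!
# Route `UnitScaleTilt`, crux «MinimiserStabilityRegPr» (stmt-QuantumFields-19200, v10 stub EX, route (α), node N06(d = 3)) — OWNER W-SEAT MAP #3 row M16, FILE B (RULING 03:25:10Z):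
# **THE «THEOREM 3.3 FOR G₀» LAYER OF THE T³ LEAF DERIVED FROM THEOREM 3.10's SCHEMAS AT THE T³ INDEX** — Track A's `BalabanUVNodesN06G0LayerFromThm310AtPins.g0_layer_of_thm310_schemas`
# (seat dag-n06-d over def-Y's members `MemberY … ∕ geo9Y`) READ AT `KIdx 2 ℓ hd3 hL b₀ b₁ ∕ geo9K` (d + 1 = 3), every threshold and constant chosen inside

Cell `ym3-torus` (HUMAN RULING D-0037, YM ladder rung R3 — NOT the Clay problem), width seat ym-ust-20520-w1 g3.  Count-neutral helper (`--supports stmt-QuantumFields-19200 --as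
helper`); registry untouched; THEOREMS ONLY (0 `def`, 0 `sorry`); NOTHING of [Balaban1985BackgroundPropagators] is asserted.

WHY (OWNER bus 03:24:57Z∕03:25:10Z).  The T³ leaves `Prop7SectET3N06Leaves(CoGlob).t313_of_pins_T3(_coGlob)` display, in `hmodel` and `hleft`, the «Theorem 3.3 for G₀» layer about Sect. D's
unperturbed BOND-sector propagator `G₀ = (Δ + DRD* + Q*aQ)⁻¹` — `Thm33G0` ((3.42)₁,₃, THE XL ITEM (N06-3-1)), the two sup-class `Step`s ((3.131)∕(3.138)), `LeftStep` ((3.42)₂ + two left steps).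
Print (p. 421): G₀ *«is the operator we have investigated in previous sections»*, i.e. `G₀ := G(U)` = the SUM of Theorem 3.10's expansion (3.107), whose inputs are Cor. 3.6's per-cube blocks
`Local342G`, the (3.89) factors, the structure identities and the Hölder ∕ input ∕ second-order ∕ mixed legs — the shape lit-balaban's carrier-generic cube module serves (✓ p599614
`B9Cor36GaugeReductionCube.thms31to33_cube_of_reg335''`).  Track A's dag-n06-d knitted n06-l's `thm33G0_of_conv3107`∕`leftStep_of_conv3107`∕`thm33G0DirR∕Dir∕L2M_of_conv3107` and
`step_of_letters3131` at def-Y's T⁴ members; THIS FILE is that knit VERBATIM at the T³ index (the theorems consumed are d-generic; the only member-specific inputs — [4] Lemma 2.1 at the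
definite exponents and p. 398's member facts — are supplied here by ★ `lemma21Pack_geo9K` (the KIdx twin of `lemma21Pack_geo9Y`, from def-Y's `levelGap_geo9K_one`∕`rowSum261_geo9K`) and
`rowSum261_geo9K`; backgrounds `bg` stay GENERIC — at `bg := Prop7SectET3BgClass.bgT3` it is the T³ leaf's regime).

WHAT IS PROVED.  ★ `lemma21Pack_geo9K`; ★★ `g0_layer_T3_of_thm310_schemas` — from one side's primitive constants `q : PinPrims` (+ `q3 : PairPrims`, `qM : MixedPrims`), the Theorem-3.10
schemas `h36A`, `h36HA`, `h36A2` in THEIR regime (M ≥ q.M₁, 0 < α₀, c₃₅Mα₀ ≤ q.a₁, (3.35)), the symmetry ∕ transposition facts of G(U), the five letter identifications G₀ := G(U) (`hblk hblkY hG0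
hD hDs`), and rows 20–21's GENUINE Sect.-D content in Theorem 3.12's regime (`hrest12`: form smallness + identities; `hstepD12`: the two left steps; `hgD12`: the G₀D entry = `Letters313.gD2`;
`hL3131`: print's (3.131)∕(3.137) letters with small local majorants) ⟹ thresholds `(M₀, a₀)` and constants `B₀, B_h, B_i, B_i2, B₂, θ₁₂ ≥ 0` such that in the regime `(M₀, a₀)` the leaf's
`hmodel` family (`Thm33G0 ∧ Step ∧ Step ∧ FormSmall ∧ Identities`, the two sup-class STEPS DERIVED), its `hleft` family (`LeftStep`) and the direction-indexed ∕ Hölder ∕ input ∕ L² companions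
(`Thm33G0Dir ∧ Thm33G0DirR ∧ Thm33G0L2M`) HOLD — i.e. EXACTLY the `hmodel`∕`hleft` binders of `t313_of_pins_T3_coGlob` at `(R₀, M₁, a₁, B₀, δ₀, θ₁, δK, r₁, θD) := (1, M₀, a₀, B₀, δ12₀, θ₁₂,
δK12, r12, θD12)`.  So after this file the `norm_G` knit's XL residue at T³ (`normG_row_of_N06d3Obligations`, ✓ p601287) reads «Theorem 3.10's schemas for `G₀,□` at curved U».
HONEST FRAMING.  Kernel bookkeeping (thresholds, constants, six applications of n06-l's theorems per member); nothing of [B9] asserted — Theorem 3.10's estimates for Bałaban's `G(U)`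
at `U ≠ 1` remain the displayed schemas `h36A h36HA h36A2`; N06(d = 3) NOT discharged; nothing here claims EX, the crux, V3∕R3, d = 4 or the mass gap; rung R3, not Clay.
Heartbeats: the main theorem keeps Track A's `maxHeartbeats 400000` (same term, same cost).

References: T. Bałaban, CMP **99** (1985) 389–434 [Balaban1985BackgroundPropagators] (Thm 3.10 (3.105)–(3.108) pp.414–416, Thm 3.3 p.399, p.421 (G₀), (3.42)–(3.46) pp.397–398,
(3.130)–(3.131) pp.421–422, (3.137)–(3.138) p.423, Thm 3.12 p.423); CMP **96** (1984) 223–250 [Balaban1984PropagatorsII] ((2.51)–(2.55) p.232, Lemma 2.1 (2.59)–(2.61) pp.233–234).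
-/

set_option autoImplicit false

noncomputable section

namespace Summit.QuantumFields.YangMills.Theorems.Prop7SectET3G0LayerFromThm310

open Literature.MathematicalPhysics.QuantumFieldTheory.Balaban1983to89
open Literature.MathematicalPhysics.QuantumFieldTheory.Balaban1983to89.B9Thm34Ext (toB6)
open Literature.MathematicalPhysics.QuantumFieldTheory.Balaban1983to89.B11SectG (BlockNorm HasMaj)
open Literature.MathematicalPhysics.QuantumFieldTheory.Balaban1983to89.B9Thm37Glue (IsTransposePair)
open Literature.MathematicalPhysics.QuantumFieldTheory.Balaban1983to89.B9Thm37Whole (const37)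
open Literature.MathematicalPhysics.QuantumFieldTheory.Balaban1983to89.B9Thm312Whole (Thm33G0 FormSmall cNorm)
open Literature.MathematicalPhysics.QuantumFieldTheory.Balaban1983to89.B9Thm312WholeLeft (LeftStep)
open Literature.MathematicalPhysics.QuantumFieldTheory.Balaban1983to89.B9Thm312WholeDir (Thm33G0Dir Thm33G0L2M)
open Literature.MathematicalPhysics.QuantumFieldTheory.Balaban1983to89.B9Thm313WholeDir (Thm33G0DirR)
open Literature.MathematicalPhysics.QuantumFieldTheory.Balaban1983to89.B9Thm310Whole
  (Ops310 StaticOK310 Sizes310 Local342G Identities310 Conv3107 conv3107_of_local3107)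
open Literature.MathematicalPhysics.QuantumFieldTheory.Balaban1983to89.B9RWSums343Holder
  (HolderProbes HolderLegs310 FactorsHolder310 holderConst)
open Literature.MathematicalPhysics.QuantumFieldTheory.Balaban1983to89.B9RWSums344Input (inputConst44 inputConst45)
open Literature.MathematicalPhysics.QuantumFieldTheory.Balaban1983to89.B9RWSums344InputPair
  (InputLegsPair310 FactorsInputPair310 DirSupHolder310)
open Literature.MathematicalPhysics.QuantumFieldTheory.Balaban1983to89.B9RWSums346SecondDiff
  (DirOps310 DirTranspose310 L2SecondLegs310 FactorsL2Second310 secondConst secondConst_nonneg)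
open Literature.MathematicalPhysics.QuantumFieldTheory.Balaban1983to89.B9RWSums346MixedPair
  (L2MixedLegs310 FactorsL2Mixed310 DirSup310 mixedConst mixedConst_nonneg)
open Literature.MathematicalPhysics.QuantumFieldTheory.Balaban1983to89.B9RWSums346Two (L2TwoLegs310 FactorsL2_310 twoConst)
open Literature.MathematicalPhysics.QuantumFieldTheory.Balaban1983to89.B9RWSums343to347Whole (Facts347)
open Literature.MathematicalPhysics.QuantumFieldTheory.Balaban1983to89.B6RandomWalk (Ineq261 c1_nonneg)
open Literature.MathematicalPhysics.QuantumFieldTheory.Balaban1983to89.B9RWSumsDefinitePins (PinPrims)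
open Literature.MathematicalPhysics.QuantumFieldTheory.Balaban1983to89.B9RWSumsDefinitePinsPair (PairPrims)
open Literature.MathematicalPhysics.QuantumFieldTheory.Balaban1983to89.B9RWSumsDefinitePinsPairM (MixedPrims)
open Literature.MathematicalPhysics.QuantumFieldTheory.Balaban1983to89.B9RWSums347DefiniteFaces (exp261 lemma21Pack_of_rowSum261)
open Literature.MathematicalPhysics.QuantumFieldTheory.Balaban1983to89.B6KLevelCensusIndexV1 (KIdx)
open Literature.MathematicalPhysics.QuantumFieldTheory.Balaban1983to89.B9GeoNormsKLevelV1 (geo9K)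
open Literature.MathematicalPhysics.QuantumFieldTheory.Balaban1983to89.B9GeoLemma21KLevelV1 (geo9K_len_pos geo9K_one_le_L geo9K_eta_pos levelGap_geo9K_one rowSum261_geo9K)
open Literature.MathematicalPhysics.QuantumFieldTheory.Balaban1983to89.B9Thm312WholeFromThm310
  (thm33G0_of_conv3107 leftStep_of_conv3107 thm33G0DirR_of_conv3107 thm33G0Dir_of_conv3107)
open Literature.MathematicalPhysics.QuantumFieldTheory.Balaban1983to89.B9Thm312WholeFromThm310L2 (thm33G0L2M_of_conv3107)
open Literature.MathematicalPhysics.QuantumFieldTheory.Balaban1983to89.B9Thm312WholeStepFrom3131 (Letters3131 step_of_letters3131)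
open Literature.MathematicalPhysics.QuantumFieldTheory.Balaban1983to89.B9Thm312Whole (GeoOK)
open Literature.MathematicalPhysics.QuantumFieldTheory.Balaban1983to89.B9Ineq349Whole (RowSum261 LevelGap)
open Literature.MathematicalPhysics.QuantumFieldTheory.Balaban1983to89.B9RWSums343to347Whole (Facts347)
open Summit.QuantumFields.YangMills.Theorems.Prop7SectET3Members (hd3)
open Summit.QuantumFields.YangMills.Theorems.Prop7SectET3Geometry (geo9K_L_le)
open Literature.MathematicalPhysics.QuantumFieldTheory.Balaban1983to89.B11SectG (RowSum)

variable {ℓ : ℕ} {hL : Odd (ℓ + 1) ∧ 1 < ℓ + 1} {b₀ b₁ : ℝ}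
variable [∀ x : KIdx 2 ℓ hd3 hL b₀ b₁, Fintype (geo9K x).Site]
  [∀ x : KIdx 2 ℓ hd3 hL b₀ b₁, DecidableEq (geo9K x).Site]
variable {c35 : ℝ} {bg : KIdx 2 ℓ hd3 hL b₀ b₁ → B9.Backgrounds}

omit [∀ x : KIdx 2 ℓ hd3 hL b₀ b₁, DecidableEq (geo9K x).Site] in
/-- ★ **ONE SIDE OF ROWS 18∕19 AT THE T³ READING `geo9K` (d + 1 = 3): ALL THREE LEMMA-2.1 BINDERS, ZERO HYPOTHESES ABOUT THE GEOMETRY** — the KIdx twin of Track A's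
`B9RWSums347DefiniteFaces.lemma21Pack_geo9Y`: `h261` (rate (δ₀, α)), `hfacts` (rate ((1 − 2α)δ₀, α_F)), `hfacts₀` (rate (δ₀, α)) under one threshold, R read as 1, L₀ = ℓ + 1, exponents
`exp261 geo9K …` — from the generic `lemma21Pack_of_rowSum261` and def-Y's `levelGap_geo9K_one`, `rowSum261_geo9K`, `geo9K_one_le_L`, `geo9K_L_le`, `geo9K_eta_pos` at `d := 2`.
[cite: Balaban1985BackgroundPropagators, Thm 3.10 p.416 + p.398 remark after (3.47); Balaban1984PropagatorsII, Lemma 2.1 (2.59)–(2.61) pp.233–234] -/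
theorem lemma21Pack_geo9K (H : KIdx 2 ℓ hd3 hL b₀ b₁ → Prop) {α δ₀ αF : ℝ} (hα : 0 < α) (hα2 : α < 1 / 2)
    (hδ₀ : 0 < δ₀) (hαF : 0 < αF) (hαF1 : αF < 1) :
    ∃ Mth : ℝ,
      (∀ x, Mth ≤ (geo9K x).M → Ineq261 (exp261 (@geo9K 2 ℓ hd3 hL b₀ b₁) δ₀ α) (toB6 (geo9K x) 1 (H x)) δ₀ α) ∧
      (∀ x, Mth ≤ (geo9K x).M →
        Facts347 (geo9K x) 1 (H x) (exp261 (@geo9K 2 ℓ hd3 hL b₀ b₁) ((1 - 2 * α) * δ₀) (1 - αF))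
          ((1 - 2 * α) * δ₀) αF ((ℓ + 1 : ℕ) : ℝ)) ∧
      (∀ x, Mth ≤ (geo9K x).M →
        Facts347 (geo9K x) 1 (H x) (exp261 (@geo9K 2 ℓ hd3 hL b₀ b₁) δ₀ (1 - α)) δ₀ α ((ℓ + 1 : ℕ) : ℝ)) :=
  lemma21Pack_of_rowSum261 one_pos levelGap_geo9K_one rowSum261_geo9K (fun x => geo9K_one_le_L x)
    (fun x => geo9K_L_le x) (fun x => geo9K_eta_pos x) H hα hα2 hδ₀ hαF hαF1

/-- «for M sufficiently large»: M ≧ 2N_Fθ₀c₁ gives N_F·θ₀M⁻¹·c₁ ≦ ½ (the located smallness of `conv3107_of_local3107`; the lineage's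
private arithmetic, restated). [folklore] -/
private theorem small_of_threshold {NF θ₀ c M : ℝ} (hM : 0 < M) (hbig : 2 * NF * θ₀ * c ≤ M) :
    NF * (θ₀ * M⁻¹) * c ≤ 1 / 2 := by
  have h1 : NF * (θ₀ * M⁻¹) * c = (NF * θ₀ * c) / M := by
    rw [div_eq_mul_inv]
    ring
  rw [h1, div_le_iff₀ hM]
  linarith

/-- n06-k's Hölder constant `holderConst` is ≧ 0 for nonnegative letters (its own nonnegativity lemma is private). [folklore] -/
private theorem holderConst_nonneg' {dd : ℕ} {δ₀ α NH NF C b t : ℝ} (hNH : 0 ≤ NH) (hNF : 0 ≤ NF) (hC : 0 ≤ C) (hb : 0 ≤ b)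
    (ht : 0 ≤ t) : 0 ≤ holderConst dd δ₀ α NH NF C b t := by
  have hc1 : 0 ≤ B6.c1 dd δ₀ α := c1_nonneg dd δ₀ α
  unfold holderConst
  have h1 : 0 ≤ 2 * NH * b * B6.c1 dd δ₀ α := mul_nonneg (mul_nonneg (mul_nonneg (by norm_num) hNH) hb) hc1
  have h2 : 0 ≤ NH * b := mul_nonneg hNH hb
  have h3 : 0 ≤ NF * t * C * B6.c1 dd δ₀ α := mul_nonneg (mul_nonneg (mul_nonneg hNF ht) hC) hc1
  linarith

/-- n06-k's (3.44) constant `inputConst44` is ≧ 0 for nonnegative letters. [folklore] -/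
private theorem inputConst44_nonneg' {d₁ : ℕ} {δ₁ α₁ NI NF C L₀ b t : ℝ} (hNI : 0 ≤ NI) (hNF : 0 ≤ NF) (hC : 0 ≤ C)
    (hL₀ : 0 ≤ L₀) (hb : 0 ≤ b) (ht : 0 ≤ t) : 0 ≤ inputConst44 d₁ δ₁ α₁ NI NF C L₀ b t := by
  have hc1 : 0 ≤ B6.c1 d₁ δ₁ α₁ := c1_nonneg d₁ δ₁ α₁
  unfold inputConst44
  exact add_nonneg (mul_nonneg hNI hb) (mul_nonneg (mul_nonneg (mul_nonneg hC (mul_nonneg hNF ht)) hL₀) hc1)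

/-- n06-k's (3.45) constant `inputConst45` is ≧ 0 for nonnegative letters. [folklore] -/
private theorem inputConst45_nonneg' {d₁ : ℕ} {δ₁ α₁ NI NF L₀ hc b t : ℝ} (hNI : 0 ≤ NI) (hNF : 0 ≤ NF) (hL₀ : 0 ≤ L₀)
    (hhc : 0 ≤ hc) (hb : 0 ≤ b) (ht : 0 ≤ t) : 0 ≤ inputConst45 d₁ δ₁ α₁ NI NF L₀ hc b t := by
  have hc1 : 0 ≤ B6.c1 d₁ δ₁ α₁ := c1_nonneg d₁ δ₁ α₁
  unfold inputConst45
  exact add_nonneg (mul_nonneg hNI hb) (mul_nonneg (mul_nonneg (mul_nonneg hhc (mul_nonneg hNF ht)) hL₀) hc1)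

set_option maxHeartbeats 400000 in
/-- ★★ **THE «THEOREM 3.3 FOR G₀» LAYER OF ROWS 20–21 FROM ROWS 18–19's THEOREM-3.10 SCHEMAS, AT def-Y's MEMBERS, EVERY THRESHOLD
AND CONSTANT CHOSEN** (module docstring).  Inputs: one side's primitive constants `q q3 qM` with their signs; the Theorem-3.10 letters
`𝔬A` (n06-k's `Ops310`), Hölder probes `𝔭A`, direction letters `𝔡A`, input norm `bHXA`, sizes `κA`, supports `SHA S3A SIA SMA S2A`, static
data `hstA hκA` and the SCHEMAS `h36A h36HA h36A2` + counts in Theorem 3.10's regime; the symmetry ∕ transposition facts `hsymA htrA`;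
the Theorem-3.12 letters `𝔬12` (`B9Thm312Whole.Ops`, same carriers) with the five identifications G₀ := G(U) (`hblk hblkY hG0 hD hDs`);
rows 20–21's numerics `θD12 r12 δ12₀ δK12 a12 M12 B12₃ δ12₃ t12 δT12 ρS σS` with their signs and rate relations; and rows 20–21's
genuine Sect.-D schemas in Theorem 3.12's regime: `hrest12` (form smallness, identities), `hstepD12` (the two left steps), `hgD12`
(the G₀D entry) and `hL3131` (the (3.131)∕(3.137) letters).  Output: thresholds M₀ ≥ M12, a₀ ≤ a12 (both positive) and constants
B₀, B_h, B_i, B_i2, B₂, θ₁₂ (with their signs) such that the certificate's three displayed families `hmodel12` (its two sup-class steps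
DERIVED), `hleft12`, `hG0C` HOLD in the regime (M₀, a₀).  Nothing of print asserted.
[cite: Balaban1985BackgroundPropagators, Thm 3.10 (3.105)–(3.108) pp.414–416 + Thm 3.3 p.399 + p.421 (G₀) + (3.42)–(3.46) pp.397–398 + (3.130)–(3.131) pp.421–422 + (3.137)–(3.138) p.423 + Thm 3.12 p.423;
Balaban1984PropagatorsII, (2.51)–(2.55) p.232 + Lemma 2.1 (2.59)–(2.61) pp.233–234] -/
theorem g0_layer_T3_of_thm310_schemas {X Y ι A PX PY Z W : KIdx 2 ℓ hd3 hL b₀ b₁ → Type} {P : KIdx 2 ℓ hd3 hL b₀ b₁ → Type}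
    [∀ x, Fintype (X x)] [∀ x, DecidableEq (X x)] [∀ x, Fintype (Y x)] [∀ x, DecidableEq (Y x)] [∀ x, Fintype (ι x)]
    [∀ x, Fintype (A x)] [∀ x, Fintype (PX x)] [∀ x, DecidableEq (PX x)] [∀ x, Fintype (PY x)] [∀ x, DecidableEq (PY x)]
    [∀ x, Fintype (Z x)] [∀ x, Fintype (W x)]
    (hc35 : 0 < c35) (q : PinPrims) (hq : q.OK) (q3 : PairPrims) (hq3 : q3.OK) (qM : MixedPrims) (hqM : qM.OK)
    (H : KIdx 2 ℓ hd3 hL b₀ b₁ → Prop)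
    -- the Theorem-3.10 letters of rows 18–19 (G side) and their schemas, VERBATIM as the certificate displays them
    (𝔬A : ∀ x : KIdx 2 ℓ hd3 hL b₀ b₁, Ops310 (geo9K x) (bg x) (X x) (Y x) (ι x) (A x))
    (𝔭A : ∀ x : KIdx 2 ℓ hd3 hL b₀ b₁, HolderProbes (geo9K x) (bg x) (X x) (Y x) (PX x) (PY x))
    (𝔡A : ∀ x : KIdx 2 ℓ hd3 hL b₀ b₁, DirOps310 (𝔬A x) (P x))
    (bHXA : ∀ x : KIdx 2 ℓ hd3 hL b₀ b₁, ℝ → BlockNorm (toB6 (geo9K x) 1 (H x)) (X x → ℝ))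
    (κA : KIdx 2 ℓ hd3 hL b₀ b₁ → Sizes310)
    (SHA S3A SIA SMA S2A : ∀ x : KIdx 2 ℓ hd3 hL b₀ b₁, ι x → Finset (geo9K x).Site)
    (hstA : ∀ x, StaticOK310 (𝔬A x) q.ρ q.Nc q.N' q.NF q.Cℓ (κA x)) (hκA : ∀ x, (κA x).Bounded q.Kc)
    (h36A : ∀ x, q.M₁ ≤ (geo9K x).M → ∀ α₀ : ℝ, 0 < α₀ → c35 * (geo9K x).M * α₀ ≤ q.a₁ →
      ∀ U : (bg x).Cfg, (bg x).Reg335 c35 α₀ U →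
        Local342G (𝔬A x) 1 (H x) q.B₀ q.δ₀ U ∧ B9Thm310Whole.Factors389 (𝔬A x) 1 (H x) q.θ₀ q.δ₀ U ∧
          Identities310 (𝔬A x) 1 (H x) U)
    (h36HA : ∀ x, q.M₁ ≤ (geo9K x).M → ∀ α₀ : ℝ, 0 < α₀ → c35 * (geo9K x).M * α₀ ≤ q.a₁ →
      ∀ U : (bg x).Cfg, (bg x).Reg335 c35 α₀ U →
        HolderLegs310 (𝔬A x) (𝔭A x) 1 (H x) (SHA x) q.Bl q.δ₀ U ∧ FactorsHolder310 (𝔬A x) (𝔭A x) 1 (H x) q.Bt q.δ₀ U ∧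
          (L2SecondLegs310 (𝔬A x) (𝔡A x) 1 (H x) (S3A x) q3.B3 q.δ₀ U ∧ FactorsL2Second310 (𝔬A x) (𝔡A x) 1 (H x) q3.θ3 q.δ₀ U ∧
            DirTranspose310 (𝔬A x) (𝔡A x) U) ∧
            (InputLegsPair310 (𝔬A x) (𝔡A x) (𝔭A x) 1 (H x) (bHXA x) (SIA x) q.BI q.BI2 q.δ₀ U ∧
              FactorsInputPair310 (𝔬A x) (𝔡A x) 1 (H x) (bHXA x) q.θI q.δ₀ U ∧ DirSupHolder310 (𝔬A x) (𝔡A x) (𝔭A x) 1 (H x) U) ∧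
              (L2MixedLegs310 (𝔬A x) (𝔡A x) 1 (H x) (SMA x) qM.BM q.δ₀ U ∧ FactorsL2Mixed310 (𝔬A x) (𝔡A x) 1 (H x) qM.θM q.δ₀ U ∧
                DirSup310 (𝔬A x) (𝔡A x) 1 (H x) U))
    -- the two-sided L² leg schema of Theorem 3.10 (the (3.46)₄ line of G(U) = ∇_UG∇*_U: n06-k's one-slot legs + their factors)
    (h36A2 : ∀ x, q.M₁ ≤ (geo9K x).M → ∀ α₀ : ℝ, 0 < α₀ → c35 * (geo9K x).M * α₀ ≤ q.a₁ →
      ∀ U : (bg x).Cfg, (bg x).Reg335 c35 α₀ U →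
        L2TwoLegs310 (𝔬A x) 1 (H x) (S2A x) q.B2 q.δ₀ U ∧ FactorsL2_310 (𝔬A x) 1 (H x) q.θ2 q.δ₀ U)
    (hcntHA : ∀ x (a : (geo9K x).Site), (∑ c, if a ∈ SHA x c then (1 : ℝ) else 0) ≤ q.NH)
    (hcnt3A : ∀ x (a : (geo9K x).Site), (∑ c, if a ∈ S3A x c then (1 : ℝ) else 0) ≤ q3.N3)
    (hcntIA : ∀ x (a : (geo9K x).Site), (∑ c, if a ∈ SIA x c then (1 : ℝ) else 0) ≤ q.NI)
    (hcntMA : ∀ x (a : (geo9K x).Site), (∑ c, if a ∈ SMA x c then (1 : ℝ) else 0) ≤ qM.NM)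
    (hcnt2A : ∀ x (a : (geo9K x).Site), (∑ c, if a ∈ S2A x c then (1 : ℝ) else 0) ≤ q.N2)
    -- the symmetry of G(U) and the transposition (∇_UG)ᵀ = G∇*_U (theorems at the pins in the certificate)
    (hsymA : ∀ x, q.M₁ ≤ (geo9K x).M → ∀ α₀ : ℝ, 0 < α₀ → c35 * (geo9K x).M * α₀ ≤ q.a₁ →
      ∀ U : (bg x).Cfg, (bg x).Reg335 c35 α₀ U → IsTransposePair ((𝔬A x).G U) ((𝔬A x).G U))
    (htrA : ∀ x, q.M₁ ≤ (geo9K x).M → ∀ α₀ : ℝ, 0 < α₀ → c35 * (geo9K x).M * α₀ ≤ q.a₁ →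
      ∀ U : (bg x).Cfg, (bg x).Reg335 c35 α₀ U →
        IsTransposePair ((𝔬A x).D U ∘ₗ (𝔬A x).G U) ((𝔬A x).G U ∘ₗ (𝔬A x).Dstar U))
    -- the Theorem-3.12 letters of rows 20–21 and the identification G₀ := G(U) (p. 421; at def-Y's pins: the same coordinate models)
    (𝔬12 : ∀ x : KIdx 2 ℓ hd3 hL b₀ b₁, B9Thm312Whole.Ops (geo9K x) (bg x) (X x) (Y x) (Z x) (W x))
    (hblk : ∀ x, (𝔬12 x).blk = (𝔬A x).blk) (hblkY : ∀ x, (𝔬12 x).blkY = (𝔬A x).blkY)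
    (hG0 : ∀ x (U : (bg x).Cfg), (𝔬12 x).G0 U = (𝔬A x).G U) (hD : ∀ x (U : (bg x).Cfg), (𝔬12 x).D U = (𝔬A x).D U)
    (hDs : ∀ x (U : (bg x).Cfg), (𝔬12 x).Dstar U = (𝔬A x).Dstar U)
    -- rows 20–21's numerics and the ONE rate relation
    (θD12 r12 δ12₀ δK12 a12 M12 B12₃ δ12₃ t12 δT12 ρS σS : ℝ) (ha12 : 0 < a12) (hM12 : 0 < M12)
    (hδ12₀ : δ12₀ ≤ (1 - 3 * q.αF) * ((1 - 2 * q.α) * q.δ₀)) (hB12₃ : 0 ≤ B12₃) (ht12 : 0 ≤ t12)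
    -- the rates of the derived sup-class steps: a working rate ρS ≤ δT12 with ρS + σS ≤ min(δ12₀, δ12₃) ([4] (2.61) at rate σS > 0) and δK12 + α_Fδ ≤ ρS
    (hσS : 0 < σS) (hρS : 0 ≤ ρS) (hρST : ρS ≤ δT12) (hρS₀ : ρS + σS ≤ δ12₀) (hρS₃ : ρS + σS ≤ δ12₃)
    (hδKS : δK12 + q.αF * ((1 - 2 * q.α) * q.δ₀) ≤ ρS)
    -- rows 20–21's GENUINE Sect.-D content in Theorem 3.12's regime: the steps, the form smallness, the identities, the two left steps
    (hrest12 : ∀ x : KIdx 2 ℓ hd3 hL b₀ b₁, M12 ≤ (geo9K x).M → ∀ α₀ : ℝ, 0 < α₀ → (geo9K x).M * α₀ ≤ a12 →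
      ∀ U : (bg x).Cfg, (bg x).Reg335 c35 α₀ U → (bg x).Reg336 c35 α₀ U →
        FormSmall (𝔬12 x) (r12 * ((geo9K x).M * α₀)) U ∧ B9Thm312Whole.Identities (𝔬12 x) U)
    -- the G₀D entry of Theorem 3.3's type (the `gD2` field of row 21's `Letters313`, displayed there)
    (hgD12 : ∀ x : KIdx 2 ℓ hd3 hL b₀ b₁, M12 ≤ (geo9K x).M → ∀ α₀ : ℝ, 0 < α₀ → (geo9K x).M * α₀ ≤ a12 →
      ∀ U : (bg x).Cfg, (bg x).Reg335 c35 α₀ U → (bg x).Reg336 c35 α₀ U →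
        HasMaj (cNorm 1 (H x) (𝔬12 x).blkW (fun y => (geo9K_len_pos x y).le) 1)
          (cNorm 1 (H x) (𝔬12 x).blk (fun y => (geo9K_len_pos x y).le) 2) ((𝔬12 x).G0 U ∘ₗ (𝔬12 x).Dv U)
          (fun a b => B12₃ * Real.exp (-(δ12₃ * (geo9K x).dist a b))))
    -- print's (3.131) ∕ (3.137): Δ′_π = T_a + D·T_b, Δ⁽²⁾_π = T_a₂ + D·T_b₂ with small local majorants t·e^{−δ_T d} (n06-l g11 `Letters3131`; FREE letters)
    (Ta Ta₂ : ∀ x : KIdx 2 ℓ hd3 hL b₀ b₁, (bg x).Cfg → Module.End ℝ (X x → ℝ))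
    (Tb Tb₂ : ∀ x : KIdx 2 ℓ hd3 hL b₀ b₁, (bg x).Cfg → (X x → ℝ) →ₗ[ℝ] (W x → ℝ))
    (hL3131 : ∀ x : KIdx 2 ℓ hd3 hL b₀ b₁, M12 ≤ (geo9K x).M → ∀ α₀ : ℝ, 0 < α₀ → (geo9K x).M * α₀ ≤ a12 →
      ∀ U : (bg x).Cfg, (bg x).Reg335 c35 α₀ U → (bg x).Reg336 c35 α₀ U →
        Letters3131 (𝔬12 x) (Ta x) (Ta₂ x) (Tb x) (Tb₂ x) 1 (H x) (fun y => (geo9K_len_pos x y).le) (t12 * ((geo9K x).M * α₀)) δT12 U)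
    (hstepD12 : ∀ x : KIdx 2 ℓ hd3 hL b₀ b₁, M12 ≤ (geo9K x).M → ∀ α₀ : ℝ, 0 < α₀ → (geo9K x).M * α₀ ≤ a12 →
      ∀ U : (bg x).Cfg, (bg x).Reg335 c35 α₀ U → (bg x).Reg336 c35 α₀ U →
        HasMaj (cNorm 1 (H x) (𝔬12 x).blk (fun y => (geo9K_len_pos x y).le) 2)
            (cNorm 1 (H x) (𝔬12 x).blkY (fun y => (geo9K_len_pos x y).le) 1)
            ((𝔬12 x).D U ∘ₗ (𝔬12 x).G0 U ∘ₗ (𝔬12 x).Tpi U)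
            (fun a b => θD12 * ((geo9K x).M * α₀) * Real.exp (-(δK12 * (toB6 (geo9K x) 1 (H x)).dist a b))) ∧
          HasMaj (cNorm 1 (H x) (𝔬12 x).blk (fun y => (geo9K_len_pos x y).le) 2)
            (cNorm 1 (H x) (𝔬12 x).blkY (fun y => (geo9K_len_pos x y).le) 1)
            ((𝔬12 x).D U ∘ₗ (𝔬12 x).G0 U ∘ₗ ((𝔬12 x).Tpi U + (𝔬12 x).T2 U))
            (fun a b => θD12 * ((geo9K x).M * α₀) * Real.exp (-(δK12 * (toB6 (geo9K x) 1 (H x)).dist a b)))) :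
    ∃ (B12₀ : ℝ) (Bh12 Bi12 : ℝ → ℝ) (Bi2₁₂ : ℝ → ℝ → ℝ) (B12₂ θ12 M₀ a₀ : ℝ),
      0 ≤ B12₀ ∧ (∀ β, 0 ≤ β → β < 1 → 0 ≤ Bh12 β) ∧ (∀ ε, 0 < ε → ε ≤ 1 → 0 ≤ Bi12 ε) ∧
        (∀ ε β, 0 < ε → ε ≤ 1 → 0 ≤ β → β < 1 → 0 ≤ Bi2₁₂ ε β) ∧ 0 ≤ B12₂ ∧ 0 ≤ θ12 ∧ 0 < M₀ ∧ 0 < a₀ ∧ M12 ≤ M₀ ∧ a₀ ≤ a12 ∧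
        (∀ x : KIdx 2 ℓ hd3 hL b₀ b₁, M₀ ≤ (geo9K x).M → ∀ α₀ : ℝ, 0 < α₀ → (geo9K x).M * α₀ ≤ a₀ →
          ∀ U : (bg x).Cfg, (bg x).Reg335 c35 α₀ U → (bg x).Reg336 c35 α₀ U →
            Thm33G0 (𝔬12 x) 1 (H x) B12₀ δ12₀ U ∧
              B9Thm312Whole.Step (𝔬12 x) 1 (H x) (fun y => (geo9K_len_pos x y).le) 1 (θ12 * ((geo9K x).M * α₀)) δK12 U ∧
                B9Thm312Whole.Step (𝔬12 x) 1 (H x) (fun y => (geo9K_len_pos x y).le) 2 (θ12 * ((geo9K x).M * α₀)) δK12 U ∧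
                  FormSmall (𝔬12 x) (r12 * ((geo9K x).M * α₀)) U ∧ B9Thm312Whole.Identities (𝔬12 x) U) ∧
        (∀ x : KIdx 2 ℓ hd3 hL b₀ b₁, M₀ ≤ (geo9K x).M → ∀ α₀ : ℝ, 0 < α₀ → (geo9K x).M * α₀ ≤ a₀ →
          ∀ U : (bg x).Cfg, (bg x).Reg335 c35 α₀ U → (bg x).Reg336 c35 α₀ U →
            LeftStep (𝔬12 x) 1 (H x) (fun y => (geo9K_len_pos x y).le) B12₀ δ12₀ (θD12 * ((geo9K x).M * α₀)) δK12 U) ∧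
        (∀ x : KIdx 2 ℓ hd3 hL b₀ b₁, M₀ ≤ (geo9K x).M → ∀ α₀ : ℝ, 0 < α₀ → (geo9K x).M * α₀ ≤ a₀ →
          ∀ U : (bg x).Cfg, (bg x).Reg335 c35 α₀ U → (bg x).Reg336 c35 α₀ U →
            Thm33G0Dir (𝔬12 x) (𝔭A x) (𝔡A x).Dd (𝔡A x).Dsd 1 (H x) (bHXA x) B12₀ Bh12 Bi12 Bi2₁₂ δ12₀ U ∧
              Thm33G0DirR (𝔬12 x) (𝔡A x).Dsd 1 (H x) B12₀ δ12₀ U ∧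
                Thm33G0L2M (𝔬12 x) (𝔡A x).Dd (𝔡A x).Dsd 1 (H x) B12₂ δ12₀ U) := by
  -- [4] Lemma 2.1 (2.61) at (δ₀, α) and p. 398's member facts at ((1 − 2α)δ₀, α_F), above ONE threshold M_L (n06-i ∕ n06-k)
  obtain ⟨ML, h261, hfacts, -⟩ :=
    lemma21Pack_geo9K (ℓ := ℓ) (hL := hL) (b₀ := b₀) (b₁ := b₁) H hq.α_pos hq.α_lt
      hq.δ₀_pos hq.αF_pos (by linarith [hq.αF_lt])
  -- the letters of the constants
  set dq : ℕ := exp261 (@geo9K 2 ℓ hd3 hL b₀ b₁) q.δ₀ q.α with hdq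
  set dF : ℕ := exp261 (@geo9K 2 ℓ hd3 hL b₀ b₁) ((1 - 2 * q.α) * q.δ₀) (1 - q.αF) with hdF
  set L₀ : ℝ := ((ℓ + 1 : ℕ) : ℝ) with hL₀
  set C : ℝ := const37 dq q.δ₀ q.α q.ρ q.B₀ q.Nc q.N' q.Cℓ q.Kc with hCdef
  set Bh : ℝ → ℝ := fun β => holderConst dq q.δ₀ q.α q.NH q.NF C (q.Bl β) (q.Bt β) with hBh
  set Bi : ℝ → ℝ := fun ε => inputConst44 dq q.δ₀ q.α q.NI q.NF C L₀ (q.BI ε) (q.θI ε) with hBi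
  set Bi2 : ℝ → ℝ → ℝ := fun ε β => inputConst45 dq q.δ₀ q.α q.NI q.NF L₀ (Bh β) (q.BI2 ε β) (q.θI (β + ε)) with hBi2
  set B₂ : ℝ := max (max (C * L₀) (secondConst dq q.δ₀ q.α q3.N3 q3.B3 q.NF q3.θ3 C L₀ * L₀))
    (max (mixedConst dq q.δ₀ q.α qM.NM qM.BM q.NF qM.θM C L₀) (twoConst dq q.δ₀ q.α q.N2 q.B2 q.NF q.θ2 C L₀)) with hB₂
  -- [4] (2.61) for the record geometry at the step's row-sum rate σS (n06-i `rowSum261_geo9K`), constant `max cσ 0`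
  obtain ⟨MLσ, cσ, hrow0⟩ := rowSum261_geo9K (d := 2) (ℓ := ℓ) (hd := hd3) (hL := hL) (b₀ := b₀) (b₁ := b₁) σS hσS
  set c' : ℝ := max cσ 0 with hc'
  have hc'0 : 0 ≤ c' := le_max_right _ _
  have hrow : ∀ x : KIdx 2 ℓ hd3 hL b₀ b₁, MLσ ≤ (geo9K x).M → RowSum (toB6 (geo9K x) 1 (H x)) σS c' :=
    fun x hM y => (hrow0 x hM y).trans (le_max_left _ _)
  set θ12 : ℝ := 2 * ((C + B12₃) * t12 * c') * L₀ with hθ12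
  set M₀ : ℝ := max M12 (max q.M₁ (max ML (max 1 (max (2 * q.NF * q.θ₀ * B6.c1 dq q.δ₀ q.α) MLσ)))) with hM₀
  set a₀ : ℝ := min a12 (q.a₁ / c35) with ha₀
  -- signs
  obtain ⟨hN3, hB3, hθ3⟩ := hq3
  obtain ⟨hNM, hBM, hθM⟩ := hqM
  have hCℓ0 : 0 ≤ q.Cℓ := zero_le_one.trans hq.one_le_Cℓ
  have hC : 0 ≤ C := B9RWSumsCompleteGeo9Y.const37_nonneg_of_signs dq hq.B₀_pos.le hq.Nc_nn hq.N'_nn hCℓ0 hq.Kc_nn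
  have hL₀1 : 1 ≤ L₀ := by rw [hL₀]; exact_mod_cast Nat.succ_le_succ (Nat.zero_le _)
  have hL₀0 : 0 ≤ L₀ := zero_le_one.trans hL₀1
  have hBh0 : ∀ β, 0 ≤ β → β < 1 → 0 ≤ Bh β := fun β hβ0 hβ1 =>
    holderConst_nonneg' hq.NH_nn hq.NF_nn hC (hq.Bl_nn β hβ0 hβ1) (hq.Bt_nn β hβ0 hβ1)
  have hBi0 : ∀ ε, 0 < ε → ε ≤ 1 → 0 ≤ Bi ε := fun ε hε hε1 =>
    inputConst44_nonneg' hq.NI_nn hq.NF_nn hC hL₀0 (hq.BI_nn ε hε hε1) (hq.θI_nn ε hε)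
  have hBi20 : ∀ ε β, 0 < ε → ε ≤ 1 → 0 ≤ β → β < 1 → 0 ≤ Bi2 ε β := fun ε β hε hε1 hβ0 hβ1 =>
    inputConst45_nonneg' hq.NI_nn hq.NF_nn hL₀0 (hBh0 β hβ0 hβ1) (hq.BI2_nn ε β hε hε1 hβ0 hβ1) (hq.θI_nn (β + ε) (by linarith))
  have hB₂0 : 0 ≤ B₂ := le_trans (mul_nonneg hC hL₀0) ((le_max_left _ _).trans (le_max_left _ _))
  have hθ12nn : 0 ≤ θ12 := mul_nonneg (mul_nonneg (by norm_num) (mul_nonneg (mul_nonneg (add_nonneg hC hB12₃) ht12) hc'0)) hL₀0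
  have hM₀pos : 0 < M₀ := lt_of_lt_of_le hM12 (le_max_left _ _)
  have ha₀pos : 0 < a₀ := lt_min ha12 (div_pos hq.a₁_pos hc35)
  -- the rates: δ := (1 − 2α)δ₀ > 0, δ12₀ ≤ (1 − 3α_F)δ ≤ (1 − α_F)δ ≤ δ ≤ (1 − α)δ₀
  have hδpos : 0 < (1 - 2 * q.α) * q.δ₀ := mul_pos (by linarith [hq.α_lt]) hq.δ₀_pos
  have hαFδ : 0 ≤ q.αF * ((1 - 2 * q.α) * q.δ₀) := mul_nonneg hq.αF_pos.le hδpos.le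
  have hρ3 : δ12₀ ≤ (1 - 3 * q.αF) * ((1 - 2 * q.α) * q.δ₀) := hδ12₀
  have hρ1 : δ12₀ ≤ (1 - q.αF) * ((1 - 2 * q.α) * q.δ₀) := by nlinarith [hρ3, hαFδ]
  have hρ0 : δ12₀ ≤ (1 - 2 * q.α) * q.δ₀ := by nlinarith [hρ1, hαFδ]
  have hδle : (1 - 2 * q.α) * q.δ₀ ≤ (1 - q.α) * q.δ₀ := by nlinarith [hq.α_pos, hq.δ₀_pos]
  have hαδ1 : q.αF * ((1 - 2 * q.α) * q.δ₀) ≤ (1 - 2 * q.α) * q.δ₀ := by nlinarith [hq.αF_lt, hδpos]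
  have hα2' : 2 * q.αF * ((1 - 2 * q.α) * q.δ₀) ≤ (1 - 2 * q.α) * q.δ₀ := by nlinarith [hq.αF_lt, hδpos]
  have hα₁δ₀ : 0 ≤ q.α * q.δ₀ := mul_nonneg hq.α_pos.le hq.δ₀_pos.le
  have hrate : (1 - 2 * q.αF) * ((1 - 2 * q.α) * q.δ₀) ≤ (1 - q.α) * q.δ₀ := by nlinarith [hq.αF_pos, hδpos, hδle]
  refine ⟨C, Bh, Bi, Bi2, B₂, θ12, M₀, a₀, hC, hBh0, hBi0, hBi20, hB₂0, hθ12nn, hM₀pos, ha₀pos, le_max_left _ _, min_le_left _ _,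
    fun x hM α₀ hα ha U hU hU' => ?_, fun x hM α₀ hα ha U hU hU' => ?_, fun x hM α₀ hα ha U hU hU' => ?_⟩
  all_goals
    -- the member's regime: above every threshold, below both smallness bounds
    have hM12x : M12 ≤ (geo9K x).M := le_trans (le_max_left _ _) hM
    have hMq : q.M₁ ≤ (geo9K x).M := le_trans ((le_max_left _ _).trans (le_max_right _ _)) hM
    have hMLx : ML ≤ (geo9K x).M := le_trans (((le_max_left _ _).trans (le_max_right _ _)).trans (le_max_right _ _)) hM
    have hM1 : 1 ≤ (geo9K x).M :=
      le_trans ((((le_max_left _ _).trans (le_max_right _ _)).trans (le_max_right _ _)).trans (le_max_right _ _)) hM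
    have hbig : 2 * q.NF * q.θ₀ * B6.c1 dq q.δ₀ q.α ≤ (geo9K x).M :=
      le_trans (((((le_max_left _ _).trans (le_max_right _ _)).trans (le_max_right _ _)).trans (le_max_right _ _)).trans
        (le_max_right _ _)) hM
    have hMLσx : MLσ ≤ (geo9K x).M :=
      le_trans (((((le_max_right _ _).trans (le_max_right _ _)).trans (le_max_right _ _)).trans (le_max_right _ _)).trans
        (le_max_right _ _)) hM
    have hMpos : 0 < (geo9K x).M := lt_of_lt_of_le one_pos hM1
    have ha12x : (geo9K x).M * α₀ ≤ a12 := ha.trans (min_le_left _ _)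
    have haq : c35 * (geo9K x).M * α₀ ≤ q.a₁ := by
      have h1 : c35 * ((geo9K x).M * α₀) ≤ c35 * (q.a₁ / c35) :=
        mul_le_mul_of_nonneg_left (ha.trans (min_le_right _ _)) hc35.le
      rw [mul_div_cancel₀ _ hc35.ne'] at h1
      simpa only [mul_assoc] using h1
    have hq' : q.NF * (q.θ₀ * (geo9K x).M⁻¹) * B6.c1 dq q.δ₀ q.α ≤ 1 / 2 := small_of_threshold hMpos hbig
    have hlen : ∀ y : (geo9K x).Site, 0 ≤ (geo9K x).len y := fun y => (geo9K_len_pos x y).le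
    obtain ⟨hl, hf, hi⟩ := h36A x hMq α₀ hα haq U hU
    obtain ⟨hL, hFH, ⟨hL3, hF3, hDT⟩, ⟨hIL, hFI, hDH⟩, ⟨hLM, hFM, hDS⟩⟩ := h36HA x hMq α₀ hα haq U hU
    obtain ⟨hL2, hF2⟩ := h36A2 x hMq α₀ hα haq U hU
    have hc : Conv3107 (𝔬A x) 1 (H x) C ((1 - 2 * q.α) * q.δ₀) U :=
      conv3107_of_local3107 (𝔬A x) 1 (H x) dq q.δ₀ q.α q.ρ q.B₀ q.Nc q.N' q.NF q.Cℓ q.Kc q.θ₀ (κA x) U hq.B₀_pos.le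
        hq.δ₀_pos.le hq.α_pos.le hq.α_lt.le hq.Nc_nn hq.N'_nn hq.NF_nn hq.one_le_Cℓ hq.Kc_nn hq.θ₀_nn hMpos (hstA x) (hκA x)
        (h261 x hMLx) hq' hl hf hi
  · have h33 : Thm33G0 (𝔬12 x) 1 (H x) C δ12₀ U :=
      thm33G0_of_conv3107 (𝔬12 x) (𝔬A x) (hblk x) (hblkY x) (hG0 x U) (hDs x U) hC hρ0 (hstA x).dnn hlen hc
    have hgeo : GeoOK (geo9K x) := ⟨(hstA x).tri, (hstA x).symm, (hstA x).dnn, (hstA x).lenpos⟩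
    have hMα : 0 ≤ (geo9K x).M * α₀ := mul_nonneg hMpos.le hα.le
    have hθ : 2 * ((C + B12₃) * (t12 * ((geo9K x).M * α₀)) * c') * L₀ ≤ θ12 * ((geo9K x).M * α₀) :=
      le_of_eq (by rw [hθ12]; ring)
    have hst := step_of_letters3131 (R₀ := 1) (H₀ := H x) hgeo (hfacts x hMLx) (hrow x hMLσx) hc'0 hC hB12₃ (mul_nonneg ht12 hMα)
      hρS hρST hρS₀ hρS₃ hαFδ hθ hδKS h33 (hgD12 x hM12x α₀ hα ha12x U hU hU') (hL3131 x hM12x α₀ hα ha12x U hU hU')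
    exact ⟨h33, hst.1, hst.2, hrest12 x hM12x α₀ hα ha12x U hU hU'⟩
  · exact leftStep_of_conv3107 (𝔬12 x) (𝔬A x) (fun y => (geo9K_len_pos x y).le) (hblk x) (hblkY x) (hG0 x U) (hD x U) hC hρ0
      (hstA x).dnn hc (hstepD12 x hM12x α₀ hα ha12x U hU hU').1 (hstepD12 x hM12x α₀ hα ha12x U hU hU').2
  · refine ⟨?_, thm33G0DirR_of_conv3107 (𝔬12 x) (𝔬A x) (𝔡A x) (hblk x) (hG0 x U) hC hρ0 (hstA x).dnn hlen hc hDS, ?_⟩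
    · exact thm33G0Dir_of_conv3107 (𝔬12 x) (𝔬A x) (𝔡A x) (𝔭A x) (bHXA x) dF dq ((1 - 2 * q.α) * q.δ₀) q.αF L₀ q.δ₀ q.α q.ρ
        q.Nc q.N' q.NF q.Cℓ q.θ₀ q.NH q.NI C δ12₀ (κA x) (SHA x) (SIA x) q.Bl q.Bt q.BI q.θI q.BI2 U (hblk x) (hblkY x) (hG0 x U)
        (hD x U) (hDs x U) hq.δ₀_pos.le hq.α_pos.le (by linarith [hq.α_lt]) hq.NF_nn hq.θ₀_nn hq.NH_nn hq.NI_nn hM1 hC hδpos.le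
        hδle hαFδ hαδ1 hρ1 hq.Bl_nn hq.Bt_nn hq.BI_nn hq.BI2_nn hq.θI_nn (hstA x) (hcntHA x) (hcntIA x) (h261 x hMLx) hq'
        (hfacts x hMLx) hf hi hL hFH hIL hFI hDS hDH hc
    · exact thm33G0L2M_of_conv3107 (𝔬12 x) (𝔬A x) (𝔡A x) dF dq ((1 - 2 * q.α) * q.δ₀) q.αF L₀ q.δ₀ q.α q.ρ q.Nc q.N' q.NF
        q.Cℓ q.N2 q.B2 q.θ2 q3.N3 q3.B3 q3.θ3 qM.NM qM.BM qM.θM C B₂ δ12₀ (κA x) (S2A x) (S3A x) (SMA x) U (hblk x) (hblkY x)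
        (hG0 x U) (hD x U) (hDs x U) hq.NF_nn hq.N2_nn hq.B2_nn hq.θ2_nn hN3 hB3 hθ3 hNM hBM hθM hM1 hC hαFδ hα2' hα₁δ₀ hrate
        ((le_max_left _ _).trans (le_max_left _ _)) ((le_max_right _ _).trans (le_max_left _ _))
        ((le_max_left _ _).trans (le_max_right _ _)) ((le_max_right _ _).trans (le_max_right _ _)) hρ3 (hstA x) (hcnt2A x)
        (hcnt3A x) (hcntMA x) (h261 x hMLx) (hfacts x hMLx) hi hL2 hF2 hL3 hF3 hLM hFM hDS hDT (hsymA x hMq α₀ hα haq U hU)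
        (htrA x hMq α₀ hα haq U hU) hc

end Summit.QuantumFields.YangMills.Theorems.Prop7SectET3G0LayerFromThm310

end
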